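/-
Copyright: the b2b-balaban T⁴-continuum CRUX team, row NE7b OWNER lineage `t4-ne7b-p1` (gen 146). Project licence.
-/
import Summits.QuantumFields.BalabanUV.T4Continuum.Spine.NE7b.SupHomogeneousThreePointTwo

/-!
# HOMOGENEOUS BOUNDS FOR CENTRED THREE- AND FOUR-POINT FUNCTIONS WITH BOUNDED VERTICES — ABSTRACT PROBABILITY (SCOPING-d17 §F,
# F9–F11: the order-5 interpolation inputs, first file).  (650)∕(654) bound `∫(B−m_B)(F−m_F)(G−m_G)` by `2β√m₄` for ONE vertex with
# `|B − m_B| ≤ 2β` and legs with fourth moments `≤ m₄`.  The order-5 entry majorant `M₅` ((610)) carries two further SUPPORTED shapes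
# needing homogeneous bounds: TWO bounded vertices against one leg, and ONE bounded vertex inside the FOUR-POINT display
# `∫B̂F̂ĜĤ − ∫B̂F̂·∫ĜĤ − ∫B̂Ĝ·∫F̂Ĥ − ∫B̂Ĥ·∫F̂Ĝ`.  On any probability space:
#   `∫|F̂| ≤ √√m₄`,   `|∫B̂₁B̂₂F̂| ≤ 4β₁β₂·√√m₄` (vertices in positions 1,2 or 2,3),   `∫|F̂||Ĝ||Ĥ| ≤ √m₄·√√m₄`,
#   `|∫B̂F̂ĜĤ − ∫B̂F̂·∫ĜĤ − ∫B̂Ĝ·∫F̂Ĥ − ∫B̂Ĥ·∫F̂Ĝ| ≤ 8β·√m₄·√√m₄` (vertex first or second)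
# — degree ONE in each `β`, NO decay (row NE7b, node U5c; (649), (650), (654) BY NAME; Mathlib measure theory; [folklore]).

Cell `pub-balaban`, sub-cell `t4`, spine estimate NE7b (`T4WeightBudget.RelWeightBound`; the cell's OWN estimate — NOT PRINTED in
[Bałaban 1983–89], NOT PROVED).  Crux-route work under `Spine/NE7b/` by the row OWNER (`t4-ne7b-p1` gen 146, file (673)) under FREEZE
(0)'s crux-prover clause; NOTHING of Bałaban's is named as a Lean object, valued or asserted; no `T4Continuum/Support` leaf typed; no
`def`, no notation; zero `sorry`.  Imports (BY NAME): the OWNER's (654) `…SupHomogeneousThreePointTwo` ((650), (649) through it).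

WHAT IS PROVED ([folklore]): `integral_abs_le_sqrt_sqrt`, `integrable_abs_of_pow_four`, **`centred_triple_le_of_two_bounded`**,
`centred_triple_le_of_two_bounded_23`, `integrable_sq_mul_sq`, `integrable_abs_triple`, `integral_abs_triple_le`, `abs_sub_sub_sub_le`,
**`centred_quad_le_of_bounded_first`**, **`centred_quad_le_of_bounded_second`**; toy.

HONEST (what this is NOT).  Abstract moment inequalities; the Gibbs∕tilted instances, the interpolated order-5 entries `M₅′` and their
weighted slot letters are the next files; scalar skeleton ((A3), NC-NE7b-α UNRULED); nothing of Bałaban's asserted.  BY-NAME EFFECT ON THE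
WALL: NONE.  NE7b NOT PRINTED ∕ NOT PROVED; spine PROVED 0∕9; rung (B)+1 — the programme's measures remain FINITE-torus statements; NOT the
mass gap, NOT Clay.  HONEST DEPENDENCY: continuum YM on T⁴ ⇐ BetaPertH ∧ nine spine estimates (0∕9 proved); BetaPertH ⇐ (D1) ∧ (D4) ∧
CAP+tail; G-an2-4 gates asym, D1 and NE2∕3∕4.
-/

set_option autoImplicit false

noncomputable section

namespace Summit.QuantumFields.BalabanUV.T4Continuum.NE7b.SupHomogeneousVertexBoundsAbstract

open MeasureTheory ProbabilityTheory Real Set Function Finset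
open scoped BigOperators
open SupWeightedSlotTools (weighted_integral_cauchy_schwarz)
open SupHomogeneousThreePoint (integrable_sq_of_pow_four sq_integral_sq_le integral_abs_mul_le_sqrt)

/-! ## §1. Bounded centred vertices against observables with fourth-moment letters (any probability measure) -/

section Abstract

variable {Ω : Type*} [MeasurableSpace Ω] {ν : Measure Ω} [IsProbabilityMeasure ν]

/-- `∫|f| ≤ √√m₄` on a probability space when `∫f⁴ ≤ m₄`. [folklore] -/
theorem integral_abs_le_sqrt_sqrt {f : Ω → ℝ} {m₄ : ℝ} (hfm : AEStronglyMeasurable f ν) (h4 : Integrable (fun ω => f ω ^ 4) ν)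
    (hm : ∫ ω, f ω ^ 4 ∂ν ≤ m₄) : ∫ ω, |f ω| ∂ν ≤ Real.sqrt (Real.sqrt m₄) := by
  have h := integral_abs_mul_le_sqrt (ν := ν) hfm aestronglyMeasurable_const h4 (g := fun _ => (1 : ℝ))
    (by simpa only [one_pow] using integrable_const (1 : ℝ))
  simp only [abs_one, mul_one, one_pow, integral_const, probReal_univ, smul_eq_mul, Real.sqrt_one] at h
  exact h.trans (Real.sqrt_le_sqrt (Real.le_sqrt_of_sq_le ((sq_integral_sq_le hfm h4).trans hm)))

/-- `|f| ∈ L¹` from `f⁴ ∈ L¹` on a probability space (`|x| ≤ 1 + x⁴`). [folklore] -/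
theorem integrable_abs_of_pow_four {f : Ω → ℝ} (hfm : AEStronglyMeasurable f ν) (h4 : Integrable (fun ω => f ω ^ 4) ν) :
    Integrable (fun ω => |f ω|) ν := by
  refine ((integrable_const (1 : ℝ)).add h4).mono' hfm.norm (ae_of_all _ fun ω => ?_)
  simp only [Pi.add_apply]
  rw [Real.norm_eq_abs, abs_abs]
  nlinarith [sq_nonneg (f ω ^ 2 - 1), sq_nonneg (|f ω| - 1), sq_abs (f ω), abs_nonneg (f ω)]

/-- **TWO BOUNDED CENTRED VERTICES AGAINST ONE OBSERVABLE**: `|B₁ − m₁| ≤ 2β₁`, `|B₂ − m₂| ≤ 2β₂` pointwise and `∫(F − m_F)⁴ ≤ m₄` give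
`|∫(B₁ − m₁)(B₂ − m₂)(F − m_F)dν| ≤ 4β₁β₂·√√m₄` — degree one in EACH `β`. [folklore] -/
theorem centred_triple_le_of_two_bounded {B₁ B₂ F : Ω → ℝ} {m₁ m₂ mF β₁ β₂ m₄ : ℝ} (hβ₁ : 0 ≤ β₁) (hβ₂ : 0 ≤ β₂)
    (hB₁ : ∀ ω, |B₁ ω - m₁| ≤ 2 * β₁) (hB₂ : ∀ ω, |B₂ ω - m₂| ≤ 2 * β₂) (hFm : AEStronglyMeasurable (fun ω => F ω - mF) ν)
    (hF4 : Integrable (fun ω => (F ω - mF) ^ 4) ν) (hmF : ∫ ω, (F ω - mF) ^ 4 ∂ν ≤ m₄) :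
    |∫ ω, (B₁ ω - m₁) * (B₂ ω - m₂) * (F ω - mF) ∂ν| ≤ 4 * β₁ * β₂ * Real.sqrt (Real.sqrt m₄) := by
  have hf1 := integrable_abs_of_pow_four hFm hF4
  have h1 : |∫ ω, (B₁ ω - m₁) * (B₂ ω - m₂) * (F ω - mF) ∂ν| ≤ 4 * β₁ * β₂ * ∫ ω, |F ω - mF| ∂ν := by
    rw [← integral_const_mul]
    refine abs_integral_le_integral_abs.trans (integral_mono_of_nonneg (ae_of_all _ fun ω => abs_nonneg _) (hf1.const_mul _)
      (ae_of_all _ fun ω => ?_))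
    dsimp only
    rw [abs_mul, abs_mul]
    calc |B₁ ω - m₁| * |B₂ ω - m₂| * |F ω - mF| ≤ 2 * β₁ * (2 * β₂) * |F ω - mF| := by gcongr; exacts [hB₁ ω, hB₂ ω]
      _ = 4 * β₁ * β₂ * |F ω - mF| := by ring
  exact h1.trans (mul_le_mul_of_nonneg_left (integral_abs_le_sqrt_sqrt hFm hF4 hmF) (by positivity))

/-- Two bounded centred vertices in positions `2, 3`: `|∫(F − m_F)(B₁ − m₁)(B₂ − m₂)dν| ≤ 4β₁β₂·√√m₄`. [folklore] -/
theorem centred_triple_le_of_two_bounded_23 {B₁ B₂ F : Ω → ℝ} {m₁ m₂ mF β₁ β₂ m₄ : ℝ} (hβ₁ : 0 ≤ β₁) (hβ₂ : 0 ≤ β₂)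
    (hB₁ : ∀ ω, |B₁ ω - m₁| ≤ 2 * β₁) (hB₂ : ∀ ω, |B₂ ω - m₂| ≤ 2 * β₂) (hFm : AEStronglyMeasurable (fun ω => F ω - mF) ν)
    (hF4 : Integrable (fun ω => (F ω - mF) ^ 4) ν) (hmF : ∫ ω, (F ω - mF) ^ 4 ∂ν ≤ m₄) :
    |∫ ω, (F ω - mF) * (B₁ ω - m₁) * (B₂ ω - m₂) ∂ν| ≤ 4 * β₁ * β₂ * Real.sqrt (Real.sqrt m₄) := by
  have e : ∫ ω, (F ω - mF) * (B₁ ω - m₁) * (B₂ ω - m₂) ∂ν = ∫ ω, (B₁ ω - m₁) * (B₂ ω - m₂) * (F ω - mF) ∂ν :=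
    integral_congr_ae (ae_of_all _ fun ω => by ring)
  rw [e]
  exact centred_triple_le_of_two_bounded hβ₁ hβ₂ hB₁ hB₂ hFm hF4 hmF

omit [IsProbabilityMeasure ν] in
/-- `f²g² ∈ L¹` from fourth moments (`2f²g² ≤ f⁴ + g⁴`). [folklore] -/
theorem integrable_sq_mul_sq {f g : Ω → ℝ} (hfm : AEStronglyMeasurable f ν) (hgm : AEStronglyMeasurable g ν)
    (hf4 : Integrable (fun ω => f ω ^ 4) ν) (hg4 : Integrable (fun ω => g ω ^ 4) ν) :
    Integrable (fun ω => f ω ^ 2 * g ω ^ 2) ν := by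
  refine ((hf4.add hg4).div_const 2).mono' ((hfm.pow 2).mul (hgm.pow 2)) (ae_of_all _ fun ω => ?_)
  simp only [Pi.add_apply]
  rw [Real.norm_eq_abs, abs_of_nonneg (mul_nonneg (sq_nonneg _) (sq_nonneg _))]
  nlinarith [sq_nonneg (f ω ^ 2 - g ω ^ 2)]

/-- `|f||g||h| ∈ L¹` from fourth moments (`2|fgh| ≤ f²g² + h²`). [folklore] -/
theorem integrable_abs_triple {f g h : Ω → ℝ} (hfm : AEStronglyMeasurable f ν) (hgm : AEStronglyMeasurable g ν)
    (hhm : AEStronglyMeasurable h ν) (hf4 : Integrable (fun ω => f ω ^ 4) ν) (hg4 : Integrable (fun ω => g ω ^ 4) ν)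
    (hh4 : Integrable (fun ω => h ω ^ 4) ν) : Integrable (fun ω => |f ω| * |g ω| * |h ω|) ν := by
  have h22 := integrable_sq_mul_sq hfm hgm hf4 hg4
  have h2 := integrable_sq_of_pow_four hhm hh4
  refine ((h22.add h2).div_const 2).mono' ((hfm.norm.mul hgm.norm).mul hhm.norm) (ae_of_all _ fun ω => ?_)
  simp only [Pi.add_apply]
  rw [Real.norm_eq_abs, abs_of_nonneg (mul_nonneg (mul_nonneg (abs_nonneg _) (abs_nonneg _)) (abs_nonneg _))]
  nlinarith [sq_nonneg (|f ω| * |g ω| - |h ω|), sq_abs (f ω), sq_abs (g ω), sq_abs (h ω)]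

/-- `∫|f||g||h| ≤ √m₄·√√m₄` on a probability space when the three fourth moments are `≤ m₄`. [folklore] -/
theorem integral_abs_triple_le {f g h : Ω → ℝ} {m₄ : ℝ} (hfm : AEStronglyMeasurable f ν) (hgm : AEStronglyMeasurable g ν)
    (hhm : AEStronglyMeasurable h ν) (hf4 : Integrable (fun ω => f ω ^ 4) ν) (hg4 : Integrable (fun ω => g ω ^ 4) ν)
    (hh4 : Integrable (fun ω => h ω ^ 4) ν) (hmf : ∫ ω, f ω ^ 4 ∂ν ≤ m₄) (hmg : ∫ ω, g ω ^ 4 ∂ν ≤ m₄) (hmh : ∫ ω, h ω ^ 4 ∂ν ≤ m₄) :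
    ∫ ω, |f ω| * |g ω| * |h ω| ∂ν ≤ Real.sqrt m₄ * Real.sqrt (Real.sqrt m₄) := by
  have hm₄ : 0 ≤ m₄ := (integral_nonneg fun ω => by positivity).trans hmf
  have h22 := integrable_sq_mul_sq hfm hgm hf4 hg4
  have h2 := integrable_sq_of_pow_four hhm hh4
  have hfgh := integrable_abs_triple hfm hgm hhm hf4 hg4 hh4
  -- Cauchy–Schwarz `∫(|f||g|)·|h| ≤ √(∫f²g²)·√(∫h²)`
  have hcs := weighted_integral_cauchy_schwarz (μ := ν) (w := fun _ => (1 : ℝ)) (f := fun ω => |f ω| * |g ω|) (g := fun ω => |h ω|)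
    (fun _ => zero_le_one) (by simpa only [one_mul, mul_assoc] using hfgh)
    (by simpa only [one_mul, mul_pow, sq_abs] using h22) (by simpa only [one_mul, sq_abs] using h2)
  simp only [one_mul, mul_pow, sq_abs] at hcs
  -- `∫f²g² ≤ m₄` by Cauchy–Schwarz and `∫h² ≤ √m₄`
  have hcs2 := weighted_integral_cauchy_schwarz (μ := ν) (w := fun _ => (1 : ℝ)) (f := fun ω => f ω ^ 2) (g := fun ω => g ω ^ 2)
    (fun _ => zero_le_one) (by simpa only [one_mul] using h22) (by simpa only [one_mul, ← pow_mul] using hf4)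
    (by simpa only [one_mul, ← pow_mul] using hg4)
  simp only [one_mul, ← pow_mul] at hcs2
  have hA : ∫ ω, f ω ^ 2 * g ω ^ 2 ∂ν ≤ m₄ := by
    refine abs_le_of_sq_le_sq' ?_ hm₄ |>.2
    calc (∫ ω, f ω ^ 2 * g ω ^ 2 ∂ν) ^ 2 ≤ (∫ ω, f ω ^ 4 ∂ν) * (∫ ω, g ω ^ 4 ∂ν) := hcs2
      _ ≤ m₄ * m₄ := mul_le_mul hmf hmg (integral_nonneg fun ω => by positivity) hm₄
      _ = m₄ ^ 2 := (sq m₄).symm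
  have hB : ∫ ω, h ω ^ 2 ∂ν ≤ Real.sqrt m₄ := Real.le_sqrt_of_sq_le ((sq_integral_sq_le hhm hh4).trans hmh)
  have hprod : (∫ ω, |f ω| * |g ω| * |h ω| ∂ν) ^ 2 ≤ (Real.sqrt m₄ * Real.sqrt (Real.sqrt m₄)) ^ 2 := by
    have e : (∫ ω, |f ω| * |g ω| * |h ω| ∂ν) = ∫ ω, |f ω| * |g ω| * |h ω| ∂ν := rfl
    calc (∫ ω, |f ω| * |g ω| * |h ω| ∂ν) ^ 2 = (∫ ω, |f ω| * (|g ω| * |h ω|) ∂ν) ^ 2 := by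
          congr 1; exact integral_congr_ae (ae_of_all _ fun ω => by ring)
      _ ≤ (∫ ω, f ω ^ 2 * g ω ^ 2 ∂ν) * (∫ ω, h ω ^ 2 ∂ν) := by
          have e2 : ∫ ω, |f ω| * (|g ω| * |h ω|) ∂ν = ∫ ω, |f ω| * |g ω| * |h ω| ∂ν := integral_congr_ae (ae_of_all _ fun ω => by ring)
          rw [e2]; exact hcs
      _ ≤ m₄ * Real.sqrt m₄ := mul_le_mul hA hB (integral_nonneg fun ω => by positivity) hm₄
      _ = (Real.sqrt m₄ * Real.sqrt (Real.sqrt m₄)) ^ 2 := by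
          rw [mul_pow, Real.sq_sqrt hm₄, Real.sq_sqrt (Real.sqrt_nonneg _)]
  exact abs_le_of_sq_le_sq' hprod (by positivity) |>.2

omit [IsProbabilityMeasure ν] in
/-- `|a − b − c − d| ≤ |a| + |b| + |c| + |d|`. [folklore] -/
theorem abs_sub_sub_sub_le (a b c d : ℝ) : |a - b - c - d| ≤ |a| + |b| + |c| + |d| := by
  have h1 := abs_sub (a - b - c) d
  have h2 := abs_sub (a - b) c
  have h3 := abs_sub a b
  linarith

/-- **A BOUNDED CENTRED VERTEX IN THE FOUR-POINT DISPLAY (vertex FIRST)**: with `B̂ = B − m_B`, `|B̂| ≤ 2β`, and `F̂, Ĝ, Ĥ` centred in the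
display's sense with fourth moments `≤ m₄`,
`|∫B̂F̂ĜĤ − ∫B̂F̂·∫ĜĤ − ∫B̂Ĝ·∫F̂Ĥ − ∫B̂Ĥ·∫F̂Ĝ| ≤ 8β·√m₄·√√m₄` — degree one in `β`, no decay. [folklore] -/
theorem centred_quad_le_of_bounded_first {B F G H : Ω → ℝ} {mB mF mG mH β m₄ : ℝ} (hβ : 0 ≤ β) (hB : ∀ ω, |B ω - mB| ≤ 2 * β)
    (hFm : AEStronglyMeasurable (fun ω => F ω - mF) ν) (hGm : AEStronglyMeasurable (fun ω => G ω - mG) ν)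
    (hHm : AEStronglyMeasurable (fun ω => H ω - mH) ν) (hF4 : Integrable (fun ω => (F ω - mF) ^ 4) ν)
    (hG4 : Integrable (fun ω => (G ω - mG) ^ 4) ν) (hH4 : Integrable (fun ω => (H ω - mH) ^ 4) ν) (hmF : ∫ ω, (F ω - mF) ^ 4 ∂ν ≤ m₄)
    (hmG : ∫ ω, (G ω - mG) ^ 4 ∂ν ≤ m₄) (hmH : ∫ ω, (H ω - mH) ^ 4 ∂ν ≤ m₄) :
    |(∫ ω, (B ω - mB) * (F ω - mF) * (G ω - mG) * (H ω - mH) ∂ν) -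
        (∫ ω, (B ω - mB) * (F ω - mF) ∂ν) * (∫ ω, (G ω - mG) * (H ω - mH) ∂ν) -
        (∫ ω, (B ω - mB) * (G ω - mG) ∂ν) * (∫ ω, (F ω - mF) * (H ω - mH) ∂ν) -
        (∫ ω, (B ω - mB) * (H ω - mH) ∂ν) * (∫ ω, (F ω - mF) * (G ω - mG) ∂ν)| ≤
      8 * β * (Real.sqrt m₄ * Real.sqrt (Real.sqrt m₄)) := by
  have hm₄ : 0 ≤ m₄ := (integral_nonneg fun ω => by positivity).trans hmF
  -- the quadruple integral
  have hFGH := integrable_abs_triple hFm hGm hHm hF4 hG4 hH4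
  have hq : |∫ ω, (B ω - mB) * (F ω - mF) * (G ω - mG) * (H ω - mH) ∂ν| ≤ 2 * β * (Real.sqrt m₄ * Real.sqrt (Real.sqrt m₄)) := by
    have h1 : |∫ ω, (B ω - mB) * (F ω - mF) * (G ω - mG) * (H ω - mH) ∂ν| ≤
        2 * β * ∫ ω, |F ω - mF| * |G ω - mG| * |H ω - mH| ∂ν := by
      rw [← integral_const_mul]
      refine abs_integral_le_integral_abs.trans (integral_mono_of_nonneg (ae_of_all _ fun ω => abs_nonneg _) (hFGH.const_mul _)
        (ae_of_all _ fun ω => ?_))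
      dsimp only
      rw [abs_mul, abs_mul, abs_mul]
      calc |B ω - mB| * |F ω - mF| * |G ω - mG| * |H ω - mH| ≤ 2 * β * |F ω - mF| * |G ω - mG| * |H ω - mH| := by gcongr; exact hB ω
        _ = 2 * β * (|F ω - mF| * |G ω - mG| * |H ω - mH|) := by ring
    exact h1.trans (mul_le_mul_of_nonneg_left (integral_abs_triple_le hFm hGm hHm hF4 hG4 hH4 hmF hmG hmH) (by positivity))
  -- a pair with the vertex: `|∫B̂X̂| ≤ 2β√√m₄`
  have hpairB : ∀ {X : Ω → ℝ} {mX : ℝ}, AEStronglyMeasurable (fun ω => X ω - mX) ν → Integrable (fun ω => (X ω - mX) ^ 4) ν →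
      ∫ ω, (X ω - mX) ^ 4 ∂ν ≤ m₄ → |∫ ω, (B ω - mB) * (X ω - mX) ∂ν| ≤ 2 * β * Real.sqrt (Real.sqrt m₄) := by
    intro X mX hXm hX4 hmX
    have hX1 := integrable_abs_of_pow_four hXm hX4
    have h1 : |∫ ω, (B ω - mB) * (X ω - mX) ∂ν| ≤ 2 * β * ∫ ω, |X ω - mX| ∂ν := by
      rw [← integral_const_mul]
      refine abs_integral_le_integral_abs.trans (integral_mono_of_nonneg (ae_of_all _ fun ω => abs_nonneg _) (hX1.const_mul _)
        (ae_of_all _ fun ω => ?_))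
      dsimp only
      rw [abs_mul]
      exact mul_le_mul_of_nonneg_right (hB ω) (abs_nonneg _)
    exact h1.trans (mul_le_mul_of_nonneg_left (integral_abs_le_sqrt_sqrt hXm hX4 hmX) (by positivity))
  -- a pair without the vertex: `|∫X̂Ŷ| ≤ √m₄`
  have hpair : ∀ {X Y' : Ω → ℝ} {mX mY : ℝ}, AEStronglyMeasurable (fun ω => X ω - mX) ν → AEStronglyMeasurable (fun ω => Y' ω - mY) ν →
      Integrable (fun ω => (X ω - mX) ^ 4) ν → Integrable (fun ω => (Y' ω - mY) ^ 4) ν → ∫ ω, (X ω - mX) ^ 4 ∂ν ≤ m₄ →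
      ∫ ω, (Y' ω - mY) ^ 4 ∂ν ≤ m₄ → |∫ ω, (X ω - mX) * (Y' ω - mY) ∂ν| ≤ Real.sqrt m₄ := by
    intro X Y' mX mY hXm hYm hX4 hY4 hmX hmY
    have hXY : Integrable (fun ω => |X ω - mX| * |Y' ω - mY|) ν := by
      have hf2 := integrable_sq_of_pow_four hXm hX4
      have hg2 := integrable_sq_of_pow_four hYm hY4
      refine ((hf2.add hg2).div_const 2).mono' (hXm.norm.mul hYm.norm) (ae_of_all _ fun ω => ?_)
      simp only [Pi.add_apply]
      rw [Real.norm_eq_abs, abs_of_nonneg (mul_nonneg (abs_nonneg _) (abs_nonneg _))]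
      nlinarith [sq_nonneg (|X ω - mX| - |Y' ω - mY|), sq_abs (X ω - mX), sq_abs (Y' ω - mY)]
    have h1 : |∫ ω, (X ω - mX) * (Y' ω - mY) ∂ν| ≤ ∫ ω, |X ω - mX| * |Y' ω - mY| ∂ν := by
      refine abs_integral_le_integral_abs.trans (integral_mono_of_nonneg (ae_of_all _ fun ω => abs_nonneg _) hXY
        (ae_of_all _ fun ω => ?_))
      dsimp only
      rw [abs_mul]
    have hX2 : ∫ ω, (X ω - mX) ^ 2 ∂ν ≤ Real.sqrt m₄ := Real.le_sqrt_of_sq_le ((sq_integral_sq_le hXm hX4).trans hmX)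
    have hY2 : ∫ ω, (Y' ω - mY) ^ 2 ∂ν ≤ Real.sqrt m₄ := Real.le_sqrt_of_sq_le ((sq_integral_sq_le hYm hY4).trans hmY)
    calc |∫ ω, (X ω - mX) * (Y' ω - mY) ∂ν| ≤ ∫ ω, |X ω - mX| * |Y' ω - mY| ∂ν := h1
      _ ≤ Real.sqrt (∫ ω, (X ω - mX) ^ 2 ∂ν) * Real.sqrt (∫ ω, (Y' ω - mY) ^ 2 ∂ν) := integral_abs_mul_le_sqrt hXm hYm hX4 hY4
      _ ≤ Real.sqrt (Real.sqrt m₄) * Real.sqrt (Real.sqrt m₄) :=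
          mul_le_mul (Real.sqrt_le_sqrt hX2) (Real.sqrt_le_sqrt hY2) (Real.sqrt_nonneg _) (Real.sqrt_nonneg _)
      _ = Real.sqrt m₄ := Real.mul_self_sqrt (Real.sqrt_nonneg _)
  have hs0 : 0 ≤ Real.sqrt (Real.sqrt m₄) := Real.sqrt_nonneg _
  have t1 : |(∫ ω, (B ω - mB) * (F ω - mF) ∂ν) * (∫ ω, (G ω - mG) * (H ω - mH) ∂ν)| ≤ 2 * β * Real.sqrt (Real.sqrt m₄) * Real.sqrt m₄ := by
    rw [abs_mul]; exact mul_le_mul (hpairB hFm hF4 hmF) (hpair hGm hHm hG4 hH4 hmG hmH) (abs_nonneg _) (by positivity)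
  have t2 : |(∫ ω, (B ω - mB) * (G ω - mG) ∂ν) * (∫ ω, (F ω - mF) * (H ω - mH) ∂ν)| ≤ 2 * β * Real.sqrt (Real.sqrt m₄) * Real.sqrt m₄ := by
    rw [abs_mul]; exact mul_le_mul (hpairB hGm hG4 hmG) (hpair hFm hHm hF4 hH4 hmF hmH) (abs_nonneg _) (by positivity)
  have t3 : |(∫ ω, (B ω - mB) * (H ω - mH) ∂ν) * (∫ ω, (F ω - mF) * (G ω - mG) ∂ν)| ≤ 2 * β * Real.sqrt (Real.sqrt m₄) * Real.sqrt m₄ := by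
    rw [abs_mul]; exact mul_le_mul (hpairB hHm hH4 hmH) (hpair hFm hGm hF4 hG4 hmF hmG) (abs_nonneg _) (by positivity)
  calc _ ≤ |∫ ω, (B ω - mB) * (F ω - mF) * (G ω - mG) * (H ω - mH) ∂ν| +
        |(∫ ω, (B ω - mB) * (F ω - mF) ∂ν) * (∫ ω, (G ω - mG) * (H ω - mH) ∂ν)| +
        |(∫ ω, (B ω - mB) * (G ω - mG) ∂ν) * (∫ ω, (F ω - mF) * (H ω - mH) ∂ν)| +
        |(∫ ω, (B ω - mB) * (H ω - mH) ∂ν) * (∫ ω, (F ω - mF) * (G ω - mG) ∂ν)| := by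
          exact abs_sub_sub_sub_le _ _ _ _
    _ ≤ 2 * β * (Real.sqrt m₄ * Real.sqrt (Real.sqrt m₄)) + 2 * β * Real.sqrt (Real.sqrt m₄) * Real.sqrt m₄ +
        2 * β * Real.sqrt (Real.sqrt m₄) * Real.sqrt m₄ + 2 * β * Real.sqrt (Real.sqrt m₄) * Real.sqrt m₄ := by gcongr
    _ = 8 * β * (Real.sqrt m₄ * Real.sqrt (Real.sqrt m₄)) := by ring

/-- **The four-point display with the bounded vertex SECOND**:
`|∫F̂B̂ĜĤ − ∫F̂B̂·∫ĜĤ − ∫F̂Ĝ·∫B̂Ĥ − ∫F̂Ĥ·∫B̂Ĝ| ≤ 8β·√m₄·√√m₄` (the first display after commuting integrands). [folklore] -/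
theorem centred_quad_le_of_bounded_second {B F G H : Ω → ℝ} {mB mF mG mH β m₄ : ℝ} (hβ : 0 ≤ β) (hB : ∀ ω, |B ω - mB| ≤ 2 * β)
    (hFm : AEStronglyMeasurable (fun ω => F ω - mF) ν) (hGm : AEStronglyMeasurable (fun ω => G ω - mG) ν)
    (hHm : AEStronglyMeasurable (fun ω => H ω - mH) ν) (hF4 : Integrable (fun ω => (F ω - mF) ^ 4) ν)
    (hG4 : Integrable (fun ω => (G ω - mG) ^ 4) ν) (hH4 : Integrable (fun ω => (H ω - mH) ^ 4) ν) (hmF : ∫ ω, (F ω - mF) ^ 4 ∂ν ≤ m₄)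
    (hmG : ∫ ω, (G ω - mG) ^ 4 ∂ν ≤ m₄) (hmH : ∫ ω, (H ω - mH) ^ 4 ∂ν ≤ m₄) :
    |(∫ ω, (F ω - mF) * (B ω - mB) * (G ω - mG) * (H ω - mH) ∂ν) -
        (∫ ω, (F ω - mF) * (B ω - mB) ∂ν) * (∫ ω, (G ω - mG) * (H ω - mH) ∂ν) -
        (∫ ω, (F ω - mF) * (G ω - mG) ∂ν) * (∫ ω, (B ω - mB) * (H ω - mH) ∂ν) -
        (∫ ω, (F ω - mF) * (H ω - mH) ∂ν) * (∫ ω, (B ω - mB) * (G ω - mG) ∂ν)| ≤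
      8 * β * (Real.sqrt m₄ * Real.sqrt (Real.sqrt m₄)) := by
  have e1 : ∫ ω, (F ω - mF) * (B ω - mB) * (G ω - mG) * (H ω - mH) ∂ν = ∫ ω, (B ω - mB) * (F ω - mF) * (G ω - mG) * (H ω - mH) ∂ν :=
    integral_congr_ae (ae_of_all _ fun ω => by ring)
  have e2 : ∫ ω, (F ω - mF) * (B ω - mB) ∂ν = ∫ ω, (B ω - mB) * (F ω - mF) ∂ν := integral_congr_ae (ae_of_all _ fun ω => by ring)
  have h := centred_quad_le_of_bounded_first hβ hB hFm hGm hHm hF4 hG4 hH4 hmF hmG hmH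
  rw [e1, e2]
  refine le_of_eq_of_le (congrArg abs (by ring)) h

end Abstract

/-! ## Toy -/

/-- Toy (in numbers): two vertices bounded by `1` (`β = ½`) against a leg with fourth moment `≤ 16` give `4·½·½·√√16 = 2`. -/
example : 4 * (1 / 2 : ℝ) * (1 / 2) * Real.sqrt (Real.sqrt 16) = 2 := by
  rw [show (16 : ℝ) = 4 ^ 2 by norm_num, Real.sqrt_sq (by norm_num), show (4 : ℝ) = 2 ^ 2 by norm_num, Real.sqrt_sq (by norm_num)]
  norm_num

end Summit.QuantumFields.BalabanUV.T4Continuum.NE7b.SupHomogeneousVertexBoundsAbstract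

end
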